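import Summits.QuantumAdvantage.QuantumAdvantage.Theorems.CertDialO
import HarnessLib

/-!
# CertDial — part P (§15c): TWO BLOCKS — the certificate against TWO-BLOCK-LOCAL answer maps

The nine inputs of `T9(a)` (part O) live on the NEAR block `{0,1,2}` and the FAR block `{a,a+1,a+2}`.  A row whose answer does not
depend on the far block cannot tell apart inputs with the same near part (`SeesNear`: the three grid rows of `T9(a)` are answered alike);
a row blind to the near block cannot tell apart inputs with the same far part (`SeesFar`: grid columns).  Summing the nine electorates of
part O over such a row, grouped by equal answers, gives an EVEN count — except for the near view at the single row `a+1` and the far view at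
the single row `1` (`nearA_even … farC_even`).  Hence (★★★ `two_blocks`) an answer map that is TWO-BLOCK-LOCAL (`TwoBlockLocal a z`: every row
has one of the two views, row `a+1` not only the near one, row `1` not only the far one) cannot win all nine: the nine parities would sum to the
odd target `0+1+1+0+1+1+1+0+0 = 5`.  Corollary `twoBlockLightLaw_five`: such a map loses an odd-class input of weight `≤ 5`.  Window-local maps of
radius `r` are two-block-local for `a = 2r+3` (`windowLocal_twoBlockLocal`), which re-proves the local light law at weight 5 from NINE inputs with
the threshold `4r + 6 ≤ n` (`windowLightLaw_five`; §14c needed `6r + 6 ≤ n`, §11 `10r + 6 ≤ n`).  Part Q places the two blocks anywhere on the ring (rotations) and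
derives the weight-5 law for all answer maps of bounded fan-in.  Credit: the family `T9(a)` is the cell census seat's (K55 «ninelights-v1» §B).
Imports part O.  Nothing here touches 27432.
`lean check` on the tree closure: rc 0, no warnings, no placeholders; axioms standard (`propext`, `Classical.choice`, `Quot.sound`).
-/

set_option linter.dupNamespace false
set_option linter.style.longLine false

noncomputable section
open scoped Classical

namespace Summit.QuantumAdvantage.QuantumAdvantage.Theorems.CertDial
open Finset
open Literature.Computability.QuantumComplexity Literature.Computability.QuantumComplexity.RingHLF
open Summit.QuantumAdvantage.AdviceFreeQNC0
open Literature.Computability.MetaComplexity Literature.Computability.MetaComplexity.Smolensky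
open Summit.QuantumAdvantage.QuantumAdvantage.Theorems.ParityDial (par offs)
open Summit.QuantumAdvantage.AdviceFreeQNC0.LightConeWindowHard (window window_apply)

variable {n : ℕ}

/-! ### §15c Views, cells and the certificate -/

/-- NEAR VIEW of row `b` on `T9(a)`: inputs with the same trace on the near block `{0,1,2}` (the grid rows `{tb₀₀,tb₀₁,tb₀₂}`,
`{tb₁₀,tb₁₁,tb₁₂}`, `{tb₂₀,quintA,quintB}`) get the same answer at `b`. -/
def SeesNear (a : ℕ) (z : (Fin n → Bool) → Fin n → Bool) (b : Fin n) : Prop :=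
  z (tb₀₀ n a) b = z (tb₀₁ n a) b ∧ z (tb₀₀ n a) b = z (tb₀₂ n a) b ∧
  z (tb₁₀ n a) b = z (tb₁₁ n a) b ∧ z (tb₁₀ n a) b = z (tb₁₂ n a) b ∧
  z (tb₂₀ n a) b = z (quintA n a) b ∧ z (tb₂₀ n a) b = z (quintB n a) b

/-- FAR VIEW of row `b`: inputs with the same trace on the far block `{a,a+1,a+2}` (the grid columns `{tb₀₀,tb₁₀,tb₂₀}`,
`{tb₀₁,tb₁₁,quintA}`, `{tb₀₂,tb₁₂,quintB}`) get the same answer at `b`. -/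
def SeesFar (a : ℕ) (z : (Fin n → Bool) → Fin n → Bool) (b : Fin n) : Prop :=
  z (tb₀₀ n a) b = z (tb₁₀ n a) b ∧ z (tb₀₀ n a) b = z (tb₂₀ n a) b ∧
  z (tb₀₁ n a) b = z (tb₁₁ n a) b ∧ z (tb₀₁ n a) b = z (quintA n a) b ∧
  z (tb₀₂ n a) b = z (tb₁₂ n a) b ∧ z (tb₀₂ n a) b = z (quintB n a) b

/-- TWO-BLOCK-LOCALITY w.r.t. `T9(a)`: every row has the near view or the far view — row `a+1` (the middle of the far block) not merely the
near one, row `1` (the middle of the near block) not merely the far one. -/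
def TwoBlockLocal (a : ℕ) (z : (Fin n → Bool) → Fin n → Bool) : Prop :=
  ∀ b : Fin n, (SeesNear a z b ∧ (b : ℕ) ≠ a + 1) ∨ (SeesFar a z b ∧ (b : ℕ) ≠ 1)

/-- a row that reads (through ANY read-set `R`) none of `a, a+1, a+2` has the near view. -/
theorem seesNear_of_reads {a : ℕ} {z : (Fin n → Bool) → Fin n → Bool} {b : Fin n} {R : Fin n → Prop}
    (hread : ∀ x x' : Fin n → Bool, (∀ d : Fin n, R d → x d = x' d) → z x b = z x' b)
    (hR : ∀ d : Fin n, R d → (d : ℕ) ≠ a ∧ (d : ℕ) ≠ a + 1 ∧ (d : ℕ) ≠ a + 2) : SeesNear a z b := by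
  refine ⟨?_, ?_, ?_, ?_, ?_, ?_⟩ <;> refine hread _ _ fun d hd => ?_ <;> have h := hR d hd <;>
    simp only [tb₀₀, tb₀₁, tb₀₂, tb₁₀, tb₁₁, tb₁₂, tb₂₀, pt, trip, quintA, quintB, decide_eq_decide] <;> omega

/-- a row that reads none of `0, 1, 2` has the far view. -/
theorem seesFar_of_reads {a : ℕ} {z : (Fin n → Bool) → Fin n → Bool} {b : Fin n} {R : Fin n → Prop}
    (hread : ∀ x x' : Fin n → Bool, (∀ d : Fin n, R d → x d = x' d) → z x b = z x' b)
    (hR : ∀ d : Fin n, R d → (d : ℕ) ≠ 0 ∧ (d : ℕ) ≠ 1 ∧ (d : ℕ) ≠ 2) : SeesFar a z b := by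
  refine ⟨?_, ?_, ?_, ?_, ?_, ?_⟩ <;> refine hread _ _ fun d hd => ?_ <;> have h := hR d hd <;>
    simp only [tb₀₀, tb₀₁, tb₀₂, tb₁₀, tb₁₁, tb₁₂, tb₂₀, pt, trip, quintA, quintB, decide_eq_decide] <;> omega

/-- bookkeeping (NEAR view): grid rows `{1,2,3}`, `{4,5,6}`, `{7,8,9}` with even coefficient sums give an even total. -/
theorem even_blocks_near {a₁ a₂ a₃ a₄ a₅ a₆ a₇ a₈ a₉ U V W : ℕ} (hA : Even (a₁ + a₂ + a₃)) (hB : Even (a₄ + a₅ + a₆))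
    (hC : Even (a₇ + a₈ + a₉)) : Even (a₁ * U + a₂ * U + a₃ * U + a₄ * V + a₅ * V + a₆ * V + a₇ * W + a₈ * W + a₉ * W) := by
  rw [show a₁ * U + a₂ * U + a₃ * U + a₄ * V + a₅ * V + a₆ * V + a₇ * W + a₈ * W + a₉ * W =
      (a₁ + a₂ + a₃) * U + (a₄ + a₅ + a₆) * V + (a₇ + a₈ + a₉) * W by ring]
  exact ((hA.mul_right _).add (hB.mul_right _)).add (hC.mul_right _)

/-- bookkeeping (FAR view): grid columns `{1,4,7}`, `{2,5,8}`, `{3,6,9}`. -/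
theorem even_blocks_far {a₁ a₂ a₃ a₄ a₅ a₆ a₇ a₈ a₉ U V W : ℕ} (hA : Even (a₁ + a₄ + a₇)) (hB : Even (a₂ + a₅ + a₈))
    (hC : Even (a₃ + a₆ + a₉)) : Even (a₁ * U + a₂ * V + a₃ * W + a₄ * U + a₅ * V + a₆ * W + a₇ * U + a₈ * V + a₉ * W) := by
  rw [show a₁ * U + a₂ * V + a₃ * W + a₄ * U + a₅ * V + a₆ * W + a₇ * U + a₈ * V + a₉ * W =
      (a₁ + a₄ + a₇) * U + (a₂ + a₅ + a₈) * V + (a₃ + a₆ + a₉) * W by ring]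
  exact ((hA.mul_right _).add (hB.mul_right _)).add (hC.mul_right _)

section Cells
variable (a b : ℕ)

/-- NEAR view, grid row `X = {0}` (electorates of `tb₀₀, tb₀₁, tb₀₂`): every row lies in an even number of them. -/
theorem nearA_even : Even ((if b % 2 = 1 then 1 else 0) + (if b % 2 = 0 ∨ a + 1 ≤ b then 1 else 0) +
    (if b % 2 = 0 ∨ b ≤ a then 1 else 0) : ℕ) := by
  rw [Nat.even_iff]; split_ifs <;> omega

/-- NEAR view, grid row `X = {1}` (`tb₁₀, tb₁₁, tb₁₂`): every row except `a+1`. -/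
theorem nearB_even (ha2 : a % 2 = 1) (hb : b ≠ a + 1) : Even ((if b % 2 = 0 then 1 else 0) +
    (if b % 2 = 1 ∨ (1 ≤ b ∧ b ≤ a - 1) then 1 else 0) + (if b % 2 = 1 ∨ a + 2 ≤ b ∨ b = 0 then 1 else 0) : ℕ) := by
  rw [Nat.even_iff]; split_ifs <;> omega

/-- NEAR view, grid row `X = {0,1,2}` (`tb₂₀, quintA, quintB`): every row except `a+1`. -/
theorem nearC_even (ha2 : a % 2 = 1) (ha : 3 ≤ a) (hb : b ≠ a + 1) : Even ((if b ≠ 1 then 1 else 0) +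
    (if b = 0 ∨ (b % 2 = 1 ∧ b ≤ a) ∨ (b % 2 = 0 ∧ a + 1 ≤ b) then 1 else 0) +
    (if b = 1 ∨ (b % 2 = 0 ∧ 2 ≤ b ∧ b ≤ a + 1) ∨ (b % 2 = 1 ∧ a + 2 ≤ b) then 1 else 0) : ℕ) := by
  rw [Nat.even_iff]; split_ifs <;> omega

/-- FAR view, grid column `Y = ∅` (`tb₀₀, tb₁₀, tb₂₀`): every row except `1`. -/
theorem farA_even (hb : b ≠ 1) : Even ((if b % 2 = 1 then 1 else 0) + (if b % 2 = 0 then 1 else 0) + (if b ≠ 1 then 1 else 0) : ℕ) := by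
  rw [Nat.even_iff]; split_ifs <;> omega

/-- FAR view, grid column `Y = {a,a+1}` (`tb₀₁, tb₁₁, quintA`): every row. -/
theorem farB_even (ha2 : a % 2 = 1) (ha : 3 ≤ a) : Even ((if b % 2 = 0 ∨ a + 1 ≤ b then 1 else 0) +
    (if b % 2 = 1 ∨ (1 ≤ b ∧ b ≤ a - 1) then 1 else 0) +
    (if b = 0 ∨ (b % 2 = 1 ∧ b ≤ a) ∨ (b % 2 = 0 ∧ a + 1 ≤ b) then 1 else 0) : ℕ) := by
  rw [Nat.even_iff]; split_ifs <;> omega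

/-- FAR view, grid column `Y = {a+1,a+2}` (`tb₀₂, tb₁₂, quintB`): every row except `1`. -/
theorem farC_even (ha2 : a % 2 = 1) (ha : 3 ≤ a) (hb : b ≠ 1) : Even ((if b % 2 = 0 ∨ b ≤ a then 1 else 0) +
    (if b % 2 = 1 ∨ a + 2 ≤ b ∨ b = 0 then 1 else 0) +
    (if b = 1 ∨ (b % 2 = 0 ∧ 2 ≤ b ∧ b ≤ a + 1) ∨ (b % 2 = 1 ∧ a + 2 ≤ b) then 1 else 0) : ℕ) := by
  rw [Nat.even_iff]; split_ifs <;> omega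

end Cells

/-- ★★★ TWO BLOCKS.  For even `n`, odd `a ≥ 3`, `a + 3 ≤ n`: every two-block-local answer map loses one of the nine inputs of `T9(a)`. -/
theorem two_blocks (he : n % 2 = 0) {a : ℕ} (ha2 : a % 2 = 1) (ha : 3 ≤ a) (han : a + 3 ≤ n)
    (z : (Fin n → Bool) → Fin n → Bool) (hz : TwoBlockLocal a z) :
    ¬ (Rel (tb₀₀ n a) (z (tb₀₀ n a)) ∧ Rel (tb₀₁ n a) (z (tb₀₁ n a)) ∧ Rel (tb₀₂ n a) (z (tb₀₂ n a)) ∧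
       Rel (tb₁₀ n a) (z (tb₁₀ n a)) ∧ Rel (tb₁₁ n a) (z (tb₁₁ n a)) ∧ Rel (tb₁₂ n a) (z (tb₁₂ n a)) ∧
       Rel (tb₂₀ n a) (z (tb₂₀ n a)) ∧ Rel (quintA n a) (z (quintA n a)) ∧ Rel (quintB n a) (z (quintB n a))) := by
  rintro ⟨H1, H2, H3, H4, H5, H6, H7, H8, H9⟩
  have h1 := (rel_tb₀₀_iff he (by omega) a _).1 H1
  have h2 := (rel_tb₀₁_iff he ha2 ha han _).1 H2
  have h3 := (rel_tb₀₂_iff he ha2 ha han _).1 H3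
  have h4 := (rel_tb₁₀_iff he (by omega) a _).1 H4
  have h5 := (rel_tb₁₁_iff he ha2 ha han _).1 H5
  have h6 := (rel_tb₁₂_iff he ha2 ha han _).1 H6
  have h7 := (rel_tb₂₀_iff he (by omega) a _).1 H7
  have h8 := (rel_quintA_iff he ha2 ha han _).1 H8
  have h9 := (rel_quintB_iff he ha2 ha han _).1 H9
  -- the per-row membership count, with answers
  set N : Fin n → ℕ := fun b =>
    (if ((b : ℕ) % 2 = 1 ∧ z (tb₀₀ n a) b = true) then 1 else 0) +
    (if (((b : ℕ) % 2 = 0 ∨ a + 1 ≤ (b : ℕ)) ∧ z (tb₀₁ n a) b = true) then 1 else 0) +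
    (if (((b : ℕ) % 2 = 0 ∨ (b : ℕ) ≤ a) ∧ z (tb₀₂ n a) b = true) then 1 else 0) +
    (if ((b : ℕ) % 2 = 0 ∧ z (tb₁₀ n a) b = true) then 1 else 0) +
    (if (((b : ℕ) % 2 = 1 ∨ (1 ≤ (b : ℕ) ∧ (b : ℕ) ≤ a - 1)) ∧ z (tb₁₁ n a) b = true) then 1 else 0) +
    (if (((b : ℕ) % 2 = 1 ∨ a + 2 ≤ (b : ℕ) ∨ (b : ℕ) = 0) ∧ z (tb₁₂ n a) b = true) then 1 else 0) +
    (if ((b : ℕ) ≠ 1 ∧ z (tb₂₀ n a) b = true) then 1 else 0) +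
    (if (((b : ℕ) = 0 ∨ ((b : ℕ) % 2 = 1 ∧ (b : ℕ) ≤ a) ∨ ((b : ℕ) % 2 = 0 ∧ a + 1 ≤ (b : ℕ))) ∧ z (quintA n a) b = true) then 1 else 0) +
    (if (((b : ℕ) = 1 ∨ ((b : ℕ) % 2 = 0 ∧ 2 ≤ (b : ℕ) ∧ (b : ℕ) ≤ a + 1) ∨ ((b : ℕ) % 2 = 1 ∧ a + 2 ≤ (b : ℕ))) ∧
      z (quintB n a) b = true) then 1 else 0) with hN
  have hsum :
      (univ.filter fun b : Fin n => (b : ℕ) % 2 = 1 ∧ z (tb₀₀ n a) b = true).card +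
      (univ.filter fun b : Fin n => ((b : ℕ) % 2 = 0 ∨ a + 1 ≤ (b : ℕ)) ∧ z (tb₀₁ n a) b = true).card +
      (univ.filter fun b : Fin n => ((b : ℕ) % 2 = 0 ∨ (b : ℕ) ≤ a) ∧ z (tb₀₂ n a) b = true).card +
      (univ.filter fun b : Fin n => (b : ℕ) % 2 = 0 ∧ z (tb₁₀ n a) b = true).card +
      (univ.filter fun b : Fin n => ((b : ℕ) % 2 = 1 ∨ (1 ≤ (b : ℕ) ∧ (b : ℕ) ≤ a - 1)) ∧ z (tb₁₁ n a) b = true).card +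
      (univ.filter fun b : Fin n => ((b : ℕ) % 2 = 1 ∨ a + 2 ≤ (b : ℕ) ∨ (b : ℕ) = 0) ∧ z (tb₁₂ n a) b = true).card +
      (univ.filter fun b : Fin n => (b : ℕ) ≠ 1 ∧ z (tb₂₀ n a) b = true).card +
      (univ.filter fun b : Fin n =>
        ((b : ℕ) = 0 ∨ ((b : ℕ) % 2 = 1 ∧ (b : ℕ) ≤ a) ∨ ((b : ℕ) % 2 = 0 ∧ a + 1 ≤ (b : ℕ))) ∧ z (quintA n a) b = true).card +
      (univ.filter fun b : Fin n =>
        ((b : ℕ) = 1 ∨ ((b : ℕ) % 2 = 0 ∧ 2 ≤ (b : ℕ) ∧ (b : ℕ) ≤ a + 1) ∨ ((b : ℕ) % 2 = 1 ∧ a + 2 ≤ (b : ℕ))) ∧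
          z (quintB n a) b = true).card = ∑ b : Fin n, N b := by
    simp only [hN, Finset.card_filter, Finset.sum_add_distrib]
  -- … is even row by row
  have heven : ∀ b : Fin n, Even (N b) := by
    intro b
    simp only [hN, ite_and_one]
    rcases hz b with ⟨⟨e01, e02, e11, e12, e21, e22⟩, hb⟩ | ⟨⟨c00, c02, c11, c12, c21, c22⟩, hb⟩
    · rw [← e01, ← e02, ← e11, ← e12, ← e21, ← e22]
      exact even_blocks_near (nearA_even a b) (nearB_even a b ha2 hb) (nearC_even a b ha2 ha hb)
    · rw [← c00, ← c02, ← c11, ← c12, ← c21, ← c22]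
      exact even_blocks_far (farA_even b hb) (farB_even a b ha2 ha) (farC_even a b ha2 ha hb)
  have htot : Even (∑ b : Fin n, N b) := Finset.even_sum _ fun b _ => heven b
  rw [← hsum, Nat.even_iff] at htot
  omega

/-- ★★★ THE TWO-BLOCK LIGHT LAW at weight 5: every two-block-local answer map (`n` even, `a` odd, `3 ≤ a`, `a + 3 ≤ n`) loses an odd-class
input of weight `≤ 5`. -/
theorem twoBlockLightLaw_five (he : n % 2 = 0) {a : ℕ} (ha2 : a % 2 = 1) (ha : 3 ≤ a) (han : a + 3 ≤ n)
    (z : (Fin n → Bool) → Fin n → Bool) (hz : TwoBlockLocal a z) : ∃ x : Fin n → Bool, OddZeros x ∧ LightDial.wt x ≤ 5 ∧ ¬ Rel x (z x) := by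
  obtain ⟨⟨o1, w1⟩, ⟨o2, w2⟩, ⟨o3, w3⟩, ⟨o4, w4⟩, ⟨o5, w5⟩, ⟨o6, w6⟩, ⟨o7, w7⟩, ⟨o8, w8⟩, ⟨o9, w9⟩⟩ := twoBlock_light (n := n) he ha han
  by_contra hall
  push Not at hall
  exact two_blocks he ha2 ha han z hz
    ⟨hall _ o1 w1, hall _ o2 w2, hall _ o3 w3, hall _ o4 w4, hall _ o5 w5, hall _ o6 w6, hall _ o7 w7, hall _ o8 w8, hall _ o9 w9⟩

/-! ### §15c′ Window-local maps are two-block-local (`a = 2r + 3`): the local light law at weight 5 from nine inputs, threshold `4r + 6 ≤ n` -/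

/-- a window-local map of radius `r` (`4r + 6 ≤ n`) is two-block-local for `a = 2r + 3`: the rows within distance `r` of the near block
`{0,1,2}` (those `≤ r+2` or `≥ n-r`) do not read the far block `{2r+3, 2r+4, 2r+5}` and miss its middle row `2r+4`; the others do not read the
near block and miss its middle row `1`. -/
theorem windowLocal_twoBlockLocal {r : ℕ} (hn : 4 * r + 6 ≤ n) {z : (Fin n → Bool) → Fin n → Bool} (hz : IsWindowLocal r z) :
    TwoBlockLocal (2 * r + 3) z := by
  intro b
  have hb := b.isLt
  have hread : ∀ x x' : Fin n → Bool, (∀ d : Fin n, ((d : ℕ) ≤ (b : ℕ) + r ∧ (b : ℕ) ≤ (d : ℕ) + r) ∨ n + (d : ℕ) ≤ (b : ℕ) + r ∨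
      n + (b : ℕ) ≤ (d : ℕ) + r → x d = x' d) → z x b = z x' b := by
    intro x x' h
    apply hz
    funext d
    have hd := d.isLt
    rw [window_apply r (by omega), window_apply r (by omega)]
    apply h
    dsimp only
    split_ifs <;> omega
  by_cases hnear : (b : ℕ) ≤ r + 2 ∨ n ≤ (b : ℕ) + r
  · left
    refine ⟨seesNear_of_reads hread fun d hd => ?_, by omega⟩
    have := d.isLt
    omega
  · right
    refine ⟨seesFar_of_reads hread fun d hd => ?_, by omega⟩
    have := d.isLt
    omega

/-- ★ THE LOCAL LIGHT LAW AT WEIGHT 5 from nine inputs: every window-local answer map of radius `r` on an even ring with `4r + 6 ≤ n` loses an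
odd-class input of weight `≤ 5` (§14c's `localLightLaw_five` needed `6r + 6 ≤ n`; §11's `five_lights` used five inputs and `10r + 6 ≤ n`). -/
theorem windowLightLaw_five (r : ℕ) (he : n % 2 = 0) (hn : 4 * r + 6 ≤ n) (z : (Fin n → Bool) → Fin n → Bool) (hz : IsWindowLocal r z) :
    ∃ x : Fin n → Bool, OddZeros x ∧ LightDial.wt x ≤ 5 ∧ ¬ Rel x (z x) :=
  twoBlockLightLaw_five he (a := 2 * r + 3) (by omega) (by omega) (by omega) z (windowLocal_twoBlockLocal hn hz)

/-! ### Axiom audit -/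

/-- info: 'Summit.QuantumAdvantage.QuantumAdvantage.Theorems.CertDial.two_blocks' depends on axioms: [propext,
 Classical.choice,
 Quot.sound] -/
#guard_msgs in #print axioms two_blocks

/-- info: 'Summit.QuantumAdvantage.QuantumAdvantage.Theorems.CertDial.windowLightLaw_five' depends on axioms: [propext,
 Classical.choice,
 Quot.sound] -/
#guard_msgs in #print axioms windowLightLaw_five

end Summit.QuantumAdvantage.QuantumAdvantage.Theorems.CertDial
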